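import Mathlib
import Literature.Computability.AlgebraicComplexity.FermionicPencil
import Summits.ValiantsHypothesis.ValiantsHypothesis.Theses.FermionicJet

/-!
# Route FermionicJet, support item `MarkedCycleExpansion` (stmt-ValiantsHypothesis-5348)

The marked-cycle (Hadamard-pairing) normal form of the cycle-counting determinant
`cdet_n = ∑_σ sgn σ · c(σ) · ∏ᵢ X_{σ i, i}` (`c(σ)` = number of cycles, fixed points included):
`cdet_n = ∑_i X_{ii} · det (X_{{i}ᶜ}) + ∑_{|S| ≥ 2} (-1)^{|S|-1} HC(X_S) · det(X_{Sᶜ})`.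
Proof: `c(σ) = #(cycle factors of σ) + #(fixed points of σ)`; exchange the sums, so that `cdet` is a
sum over pairs (σ, marked cycle); a permutation stabilising a set `S` is uniquely
`ofSubtype π * ofSubtype τ` with `π ∈ Perm S`, `τ ∈ Perm Sᶜ`, and the marked cycle has support `S`
iff `π` is a full cycle on `S` (sign `(-1)^{|S|-1}`); fixed points `i` are the case `S = {i}`.
Main result: `markedCycleExpansion_proof : MarkedCycleExpansion`. -/

noncomputable section
set_option linter.dupNamespace false

open MvPolynomial Finset Equiv Equiv.Perm

namespace Summit.ValiantsHypothesis.ValiantsHypothesis.Theorems.FermionicJetMarkedCycleExpansion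

/-! ### Permutations stabilising a finite set -/

section Perm

variable {α : Type*} [Fintype α] [DecidableEq α]

/-- On `S`, `ofSubtype π * ofSubtype τ` acts as `π`. -/
theorem ofSubtype_mul_ofSubtype_apply_coe (S : Finset α) (π : Perm ↥S) (τ : Perm ↥(Sᶜ))
    (a : ↥S) : (ofSubtype π * ofSubtype τ) (a : α) = (π a : α) := by
  rw [Perm.mul_apply, ofSubtype_apply_of_not_mem τ (fun h => (Finset.mem_compl.1 h) a.2),
    ofSubtype_apply_coe]

/-- On `S`, `ofSubtype π * ofSubtype τ` acts as `π` (membership form). -/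
theorem ofSubtype_mul_ofSubtype_apply_of_mem (S : Finset α) (π : Perm ↥S) (τ : Perm ↥(Sᶜ))
    {x : α} (hx : x ∈ S) : (ofSubtype π * ofSubtype τ) x = (π ⟨x, hx⟩ : α) :=
  ofSubtype_mul_ofSubtype_apply_coe S π τ ⟨x, hx⟩

/-- On `Sᶜ`, `ofSubtype π * ofSubtype τ` acts as `τ`. -/
theorem ofSubtype_mul_ofSubtype_apply_coe_compl (S : Finset α) (π : Perm ↥S) (τ : Perm ↥(Sᶜ))
    (b : ↥(Sᶜ)) : (ofSubtype π * ofSubtype τ) (b : α) = (τ b : α) := by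
  rw [Perm.mul_apply, ofSubtype_apply_coe,
    ofSubtype_apply_of_not_mem π (Finset.mem_compl.1 (τ b).2)]

/-- **Stabiliser decomposition.** A sum over the permutations of `α` mapping `S` into itself is
the double sum over `Perm S × Perm Sᶜ` through `(π, τ) ↦ ofSubtype π * ofSubtype τ`. -/
theorem sum_filter_stabilizes_eq {β : Type*} [AddCommMonoid β] (S : Finset α) (g : Perm α → β) :
    ∑ σ ∈ univ.filter (fun σ : Perm α => ∀ x ∈ S, σ x ∈ S), g σ =
      ∑ π : Perm ↥S, ∑ τ : Perm ↥(Sᶜ), g (ofSubtype π * ofSubtype τ) := by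
  rw [← Finset.sum_product']
  symm
  refine Finset.sum_nbij (fun x => ofSubtype x.1 * ofSubtype x.2) ?_ ?_ ?_ (fun _ _ => rfl)
  · rintro ⟨π, τ⟩ _
    simp only [Finset.mem_filter, Finset.mem_univ, true_and]
    intro x hx
    rw [ofSubtype_mul_ofSubtype_apply_of_mem S π τ hx]
    exact (π ⟨x, hx⟩).2
  · rintro ⟨π, τ⟩ _ ⟨π', τ'⟩ _ h
    simp only at h
    have hπ : π = π' := by
      ext a
      rw [← ofSubtype_mul_ofSubtype_apply_coe S π τ a, h, ofSubtype_mul_ofSubtype_apply_coe]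
    have hτ : τ = τ' := by
      ext b
      rw [← ofSubtype_mul_ofSubtype_apply_coe_compl S π τ b, h,
        ofSubtype_mul_ofSubtype_apply_coe_compl]
    rw [hπ, hτ]
  · intro σ hσ
    simp only [Finset.coe_filter, Finset.mem_univ, true_and, Set.mem_setOf_eq] at hσ
    have h1 : ∀ x, σ x ∈ S ↔ x ∈ S := fun x =>
      ⟨fun h => by simpa using perm_symm_on_of_perm_on_finset hσ h, hσ x⟩
    have h2 : ∀ x, σ x ∈ Sᶜ ↔ x ∈ Sᶜ := fun x => by
      simp only [Finset.mem_compl, h1]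
    refine ⟨(σ.subtypePerm h1, σ.subtypePerm h2), by simp, ?_⟩
    ext x
    simp only [Perm.mul_apply]
    by_cases hx : x ∈ S
    · rw [ofSubtype_subtypePerm_of_not_mem h2 (fun h => Finset.mem_compl.1 h hx),
        ofSubtype_subtypePerm_of_mem h1 hx]
    · rw [ofSubtype_subtypePerm_of_mem h2 (Finset.mem_compl.2 hx),
        ofSubtype_subtypePerm_of_not_mem h1 (fun h => hx ((h1 x).1 h))]

/-- The graph monomial of `ofSubtype π * ofSubtype τ` splits over `S` and `Sᶜ`. -/
theorem prod_ofSubtype_mul_ofSubtype {M : Type*} [CommMonoid M] (S : Finset α) (π : Perm ↥S)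
    (τ : Perm ↥(Sᶜ)) (f : α → α → M) :
    ∏ x, f ((ofSubtype π * ofSubtype τ) x) x =
      (∏ a : ↥S, f (π a) a) * ∏ b : ↥(Sᶜ), f (τ b) b := by
  rw [← Finset.prod_mul_prod_compl S, ← Finset.prod_coe_sort S, ← Finset.prod_coe_sort Sᶜ]
  congr 1
  · exact Fintype.prod_congr _ _ fun a => by rw [ofSubtype_mul_ofSubtype_apply_coe]
  · exact Fintype.prod_congr _ _ fun b => by rw [ofSubtype_mul_ofSubtype_apply_coe_compl]

/-- The sign of `ofSubtype π * ofSubtype τ` is `sign π * sign τ`. -/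
theorem sign_ofSubtype_mul_ofSubtype (S : Finset α) (π : Perm ↥S) (τ : Perm ↥(Sᶜ)) :
    Perm.sign (ofSubtype π * ofSubtype τ) = Perm.sign π * Perm.sign τ := by
  rw [Perm.sign_mul, sign_ofSubtype, sign_ofSubtype]

/-- A cycle factor of `ofSubtype π * ofSubtype τ` has support exactly `S` iff `π` is a full cycle
on `S`. -/
theorem exists_mem_cycleFactorsFinset_support_eq_iff (S : Finset α) (π : Perm ↥S)
    (τ : Perm ↥(Sᶜ)) :
    (∃ c ∈ (ofSubtype π * ofSubtype τ).cycleFactorsFinset, c.support = S) ↔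
      π.cycleType = {S.card} := by
  constructor
  · rintro ⟨c, hc, hcS⟩
    rw [mem_cycleFactorsFinset_iff] at hc
    obtain ⟨hcyc, hagree⟩ := hc
    have hc_eq : c = ofSubtype π := by
      ext x
      by_cases hx : x ∈ S
      · rw [hagree x (hcS ▸ hx), ofSubtype_mul_ofSubtype_apply_of_mem S π τ hx,
          ofSubtype_apply_of_mem π hx]
      · rw [ofSubtype_apply_of_not_mem π hx, ← Perm.notMem_support, hcS]
        exact hx
    have : π.cycleType = c.cycleType := by rw [hc_eq, cycleType_ofSubtype]
    rw [this, hcyc.cycleType, hcS]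
  · intro hπ
    have hsuppπ : π.support = univ := by
      apply Finset.eq_univ_of_card
      rw [← sum_cycleType, hπ, Multiset.sum_singleton, Fintype.card_coe]
    have hsupp : (ofSubtype π).support = S := by
      ext x
      rw [Perm.mem_support]
      by_cases hx : x ∈ S
      · rw [ofSubtype_apply_of_mem π hx]
        have h1 : π ⟨x, hx⟩ ≠ ⟨x, hx⟩ := Perm.mem_support.1 (hsuppπ ▸ Finset.mem_univ _)
        exact ⟨fun _ => hx, fun _ h => h1 (Subtype.ext h)⟩
      · rw [ofSubtype_apply_of_not_mem π hx]
        exact ⟨fun h => absurd rfl h, fun h => absurd h hx⟩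
    refine ⟨ofSubtype π, ?_, hsupp⟩
    rw [mem_cycleFactorsFinset_iff]
    refine ⟨?_, fun a ha => ?_⟩
    · rw [← card_cycleType_eq_one, cycleType_ofSubtype, hπ, Multiset.card_singleton]
    · rw [hsupp] at ha
      rw [ofSubtype_apply_of_mem π ha, ofSubtype_mul_ofSubtype_apply_of_mem S π τ ha]

/-- A cycle factor with support `S` forces the permutation to stabilise `S`. -/
theorem stabilizes_of_mem_cycleFactorsFinset {σ c : Perm α} (hc : c ∈ σ.cycleFactorsFinset)
    {x : α} (hx : x ∈ c.support) : σ x ∈ c.support := by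
  rw [mem_cycleFactorsFinset_iff] at hc
  rw [← hc.2 x hx]
  exact Perm.apply_mem_support.2 hx

/-- Distinct cycle factors have distinct supports: `support` is injective on the cycle factors,
so the number of cycle factors is the number of their supports. -/
theorem card_image_support_cycleFactorsFinset (σ : Perm α) :
    (σ.cycleFactorsFinset.image Perm.support).card = σ.cycleFactorsFinset.card := by
  refine Finset.card_image_of_injOn fun c hc d hd h => ?_
  by_contra hne
  have hdisj := (cycleFactorsFinset_pairwise_disjoint σ hc hd hne).disjoint_support
  rw [h, Finset.disjoint_self_iff_empty] at hdisj
  have h2 := (mem_cycleFactorsFinset_iff.1 (Finset.mem_coe.1 hd)).1.two_le_card_support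
  rw [hdisj, Finset.card_empty] at h2
  omega

/-- The number of nontrivial cycles is the number of cycle factors. -/
theorem card_cycleType_eq_card_cycleFactorsFinset (σ : Perm α) :
    Multiset.card σ.cycleType = σ.cycleFactorsFinset.card := by
  rw [cycleType_def, Multiset.card_map, Finset.card_val]

omit [Fintype α] [DecidableEq α] in
/-- A permutation of a singleton is the identity. -/
theorem perm_coe_singleton_eq_one (i : α) (π : Perm ↥({i} : Finset α)) : π = 1 := by
  have : Subsingleton ↥({i} : Finset α) := by
    refine ⟨fun a b => Subtype.ext ?_⟩
    rw [Finset.mem_singleton.1 a.2, Finset.mem_singleton.1 b.2]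
  exact Subsingleton.elim _ _

omit [Fintype α] in
/-- The sign of a full cycle on `S` is `(-1)^{|S|-1}` (as an integer cast into a ring). -/
theorem sign_of_cycleType_eq_card {k : Type*} [CommRing k] (S : Finset α) (π : Perm ↥S)
    (hπ : π.cycleType = {S.card}) :
    (((Perm.sign π : ℤˣ) : ℤ) : k) = (-1) ^ (S.card - 1) := by
  rw [sign_eq_neg_one_pow_card_sub_numCycles, Fintype.card_coe,
    numCycles_of_cycleType_eq π (by rw [hπ, Fintype.card_coe])]
  push_cast
  rfl

omit [Fintype α] in
/-- Fewer than two points carry no full cycle: the Hamiltonian filter on `Perm S` is empty. -/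
theorem filter_cycleType_eq_card_eq_empty (S : Finset α) (h : ¬ 2 ≤ S.card) :
    univ.filter (fun π : Perm ↥S => π.cycleType = {S.card}) = ∅ := by
  refine Finset.filter_eq_empty_iff.2 fun π _ hπ => h ?_
  exact two_le_of_mem_cycleType (by rw [hπ]; exact Multiset.mem_singleton_self _)

end Perm

/-! ### The polynomial identity -/

section Poly

open Literature.Computability.AlgebraicComplexity

variable {α : Type*} [Fintype α] [DecidableEq α] {k : Type*} [CommRing k]

omit [Fintype α] in
/-- The renamed principal-minor determinant `det(X_T)` as a signed permutation sum in the
variables `X_{ab}`, `a b ∈ T`. -/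
theorem rename_detPoly_coe (T : Finset α) :
    rename (fun p : ↥T × ↥T => ((p.1 : α), (p.2 : α))) (detPoly ↥T k) =
      ∑ τ : Perm ↥T, C (((Perm.sign τ : ℤˣ) : ℤ) : k) *
        ∏ b : ↥T, (X (((τ b : ↥T) : α), (b : α)) : MvPolynomial (α × α) k) := by
  rw [detPoly_eq_sum, map_sum]
  refine Finset.sum_congr rfl fun τ _ => ?_
  rw [map_mul, rename_C, map_prod]
  simp only [rename_X]

omit [Fintype α] in
/-- The renamed principal Hamiltonian cycle polynomial `HC(X_S)` as a sum over the full cycles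
of `S`. -/
theorem rename_hcPoly_coe (S : Finset α) :
    rename (fun p : ↥S × ↥S => ((p.1 : α), (p.2 : α))) (hcPoly ↥S k) =
      ∑ π ∈ univ.filter (fun π : Perm ↥S => π.cycleType = {S.card}),
        ∏ a : ↥S, (X (((π a : ↥S) : α), (a : α)) : MvPolynomial (α × α) k) := by
  unfold hcPoly Matrix.hamiltonianCycleSum
  rw [map_sum, Fintype.card_coe]
  refine Finset.sum_congr rfl fun π _ => ?_
  rw [map_prod]
  simp only [Matrix.mvPolynomialX_apply, rename_X]

/-- **Fixed points.** `∑_σ #Fix(σ) · sgn σ · x^σ = ∑_i X_{ii} · det(X_{{i}ᶜ})`. -/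
theorem sum_card_fixedPoints_smul_eq :
    ∑ σ : Perm α, (univ.filter fun i => σ i = i).card •
        (C (((Perm.sign σ : ℤˣ) : ℤ) : k) * ∏ i, (X (σ i, i) : MvPolynomial (α × α) k)) =
      ∑ i : α, X (i, i) * rename (fun p : ↥(({i} : Finset α)ᶜ) × ↥(({i} : Finset α)ᶜ) =>
        ((p.1 : α), (p.2 : α))) (detPoly ↥(({i} : Finset α)ᶜ) k) := by
  have h1 : ∀ σ : Perm α, (univ.filter fun i => σ i = i).card •
      (C (((Perm.sign σ : ℤˣ) : ℤ) : k) * ∏ i, (X (σ i, i) : MvPolynomial (α × α) k)) =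
      ∑ i, if σ i = i then
        C (((Perm.sign σ : ℤˣ) : ℤ) : k) * ∏ i, (X (σ i, i) : MvPolynomial (α × α) k) else 0 := by
    intro σ
    rw [← Finset.sum_filter, Finset.sum_const]
  rw [Finset.sum_congr rfl fun σ _ => h1 σ, Finset.sum_comm]
  refine Finset.sum_congr rfl fun i _ => ?_
  rw [← Finset.sum_filter]
  have hfilter : (univ.filter fun σ : Perm α => σ i = i) =
      univ.filter (fun σ : Perm α => ∀ x ∈ ({i} : Finset α), σ x ∈ ({i} : Finset α)) := by
    refine Finset.filter_congr fun σ _ => ?_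
    simp only [Finset.mem_singleton, forall_eq]
  rw [hfilter, sum_filter_stabilizes_eq]
  have huniv : (univ : Finset (Perm ↥({i} : Finset α))) = {1} := by
    ext π
    simp only [Finset.mem_univ, Finset.mem_singleton, true_iff]
    exact perm_coe_singleton_eq_one i π
  rw [huniv, Finset.sum_singleton, rename_detPoly_coe, Finset.mul_sum]
  refine Finset.sum_congr rfl fun τ _ => ?_
  rw [sign_ofSubtype_mul_ofSubtype, Perm.sign_one, one_mul,
    prod_ofSubtype_mul_ofSubtype ({i} : Finset α) 1 τ
      (fun a b => (X (a, b) : MvPolynomial (α × α) k))]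
  have hprod : ∏ a : ↥({i} : Finset α),
      (X ((((1 : Perm ↥({i} : Finset α)) a : ↥({i} : Finset α)) : α), (a : α)) :
        MvPolynomial (α × α) k) = X (i, i) := by
    simp only [Perm.coe_one, id_eq]
    rw [Finset.prod_coe_sort {i} (fun x => (X (x, x) : MvPolynomial (α × α) k)),
      Finset.prod_singleton]
  rw [hprod, mul_left_comm]

/-- **Marked full cycles on a fixed support.** For a set `S`, the graph terms of the
permutations `ofSubtype π * ofSubtype τ` with `π` a full cycle on `S` sum to
`(-1)^{|S|-1} HC(X_S) det(X_{Sᶜ})`. -/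
theorem sum_filter_cycleType_eq_card_eq (S : Finset α) :
    ∑ π ∈ univ.filter (fun π : Perm ↥S => π.cycleType = {S.card}), ∑ τ : Perm ↥(Sᶜ),
        (C (((Perm.sign (ofSubtype π * ofSubtype τ) : ℤˣ) : ℤ) : k) *
          ∏ i, (X ((ofSubtype π * ofSubtype τ) i, i) : MvPolynomial (α × α) k)) =
      C ((-1 : k) ^ (S.card - 1)) *
        rename (fun p : ↥S × ↥S => ((p.1 : α), (p.2 : α))) (hcPoly ↥S k) *
        rename (fun p : ↥(Sᶜ) × ↥(Sᶜ) => ((p.1 : α), (p.2 : α))) (detPoly ↥(Sᶜ) k) := by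
  rw [rename_hcPoly_coe, rename_detPoly_coe]
  have hterm : ∀ π ∈ univ.filter (fun π : Perm ↥S => π.cycleType = {S.card}),
      ∀ τ : Perm ↥(Sᶜ),
      C (((Perm.sign (ofSubtype π * ofSubtype τ) : ℤˣ) : ℤ) : k) *
          ∏ i, (X ((ofSubtype π * ofSubtype τ) i, i) : MvPolynomial (α × α) k) =
        (C ((-1 : k) ^ (S.card - 1)) *
          ∏ a : ↥S, (X (((π a : ↥S) : α), (a : α)) : MvPolynomial (α × α) k)) *
        (C (((Perm.sign τ : ℤˣ) : ℤ) : k) *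
          ∏ b : ↥(Sᶜ), (X (((τ b : ↥(Sᶜ)) : α), (b : α)) : MvPolynomial (α × α) k)) := by
    intro π hπ τ
    rw [sign_ofSubtype_mul_ofSubtype, prod_ofSubtype_mul_ofSubtype S π τ
        (fun a b => (X (a, b) : MvPolynomial (α × α) k)),
      Units.val_mul, Int.cast_mul, sign_of_cycleType_eq_card S π (Finset.mem_filter.1 hπ).2,
      map_mul]
    ring
  rw [Finset.sum_congr rfl fun π hπ => Finset.sum_congr rfl fun τ _ => hterm π hπ τ]
  have hin : ∀ π : Perm ↥S,
      ∑ τ : Perm ↥(Sᶜ), (C ((-1 : k) ^ (S.card - 1)) *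
          ∏ a : ↥S, (X (((π a : ↥S) : α), (a : α)) : MvPolynomial (α × α) k)) *
        (C (((Perm.sign τ : ℤˣ) : ℤ) : k) *
          ∏ b : ↥(Sᶜ), (X (((τ b : ↥(Sᶜ)) : α), (b : α)) : MvPolynomial (α × α) k)) =
      (C ((-1 : k) ^ (S.card - 1)) *
          ∏ a : ↥S, (X (((π a : ↥S) : α), (a : α)) : MvPolynomial (α × α) k)) *
        ∑ τ : Perm ↥(Sᶜ), (C (((Perm.sign τ : ℤˣ) : ℤ) : k) *
          ∏ b : ↥(Sᶜ), (X (((τ b : ↥(Sᶜ)) : α), (b : α)) : MvPolynomial (α × α) k)) := by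
    intro π
    rw [Finset.mul_sum]
  rw [Finset.sum_congr rfl fun π _ => hin π, ← Finset.sum_mul]
  congr 1
  rw [Finset.mul_sum]

/-- **Cycle factors.** `∑_σ #(cycle factors of σ) · sgn σ · x^σ =
∑_{|S| ≥ 2} (-1)^{|S|-1} HC(X_S) det(X_{Sᶜ})`. -/
theorem sum_card_cycleFactorsFinset_smul_eq :
    ∑ σ : Perm α, σ.cycleFactorsFinset.card •
        (C (((Perm.sign σ : ℤˣ) : ℤ) : k) * ∏ i, (X (σ i, i) : MvPolynomial (α × α) k)) =
      ∑ S : Finset α, (if 2 ≤ S.card then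
        C ((-1 : k) ^ (S.card - 1)) *
          rename (fun p : ↥S × ↥S => ((p.1 : α), (p.2 : α))) (hcPoly ↥S k) *
          rename (fun p : ↥(Sᶜ) × ↥(Sᶜ) => ((p.1 : α), (p.2 : α))) (detPoly ↥(Sᶜ) k)
        else 0) := by
  have h1 : ∀ σ : Perm α, σ.cycleFactorsFinset.card •
      (C (((Perm.sign σ : ℤˣ) : ℤ) : k) * ∏ i, (X (σ i, i) : MvPolynomial (α × α) k)) =
      ∑ S : Finset α, if S ∈ σ.cycleFactorsFinset.image Perm.support then
        C (((Perm.sign σ : ℤˣ) : ℤ) : k) * ∏ i, (X (σ i, i) : MvPolynomial (α × α) k) else 0 := by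
    intro σ
    rw [Finset.sum_ite_mem, Finset.univ_inter, Finset.sum_const,
      card_image_support_cycleFactorsFinset]
  rw [Finset.sum_congr rfl fun σ _ => h1 σ, Finset.sum_comm]
  refine Finset.sum_congr rfl fun S _ => ?_
  -- only permutations stabilising `S` contribute
  have h2 : ∑ σ : Perm α, (if S ∈ σ.cycleFactorsFinset.image Perm.support then
        C (((Perm.sign σ : ℤˣ) : ℤ) : k) * ∏ i, (X (σ i, i) : MvPolynomial (α × α) k) else 0) =
      ∑ σ ∈ univ.filter (fun σ : Perm α => ∀ x ∈ S, σ x ∈ S),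
        (if S ∈ σ.cycleFactorsFinset.image Perm.support then
          C (((Perm.sign σ : ℤˣ) : ℤ) : k) * ∏ i, (X (σ i, i) : MvPolynomial (α × α) k)
          else 0) := by
    symm
    refine Finset.sum_subset (Finset.filter_subset _ _) fun σ _ hσ => ?_
    rw [if_neg]
    intro hS
    apply hσ
    simp only [Finset.mem_filter, Finset.mem_univ, true_and]
    obtain ⟨c, hc, rfl⟩ := Finset.mem_image.1 hS
    exact fun x hx => stabilizes_of_mem_cycleFactorsFinset hc hx
  rw [h2, sum_filter_stabilizes_eq]
  have h3 : ∀ π : Perm ↥S, (∑ τ : Perm ↥(Sᶜ),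
        if S ∈ (ofSubtype π * ofSubtype τ).cycleFactorsFinset.image Perm.support then
          C (((Perm.sign (ofSubtype π * ofSubtype τ) : ℤˣ) : ℤ) : k) *
            ∏ i, (X ((ofSubtype π * ofSubtype τ) i, i) : MvPolynomial (α × α) k) else 0) =
      if π.cycleType = {S.card} then ∑ τ : Perm ↥(Sᶜ),
        C (((Perm.sign (ofSubtype π * ofSubtype τ) : ℤˣ) : ℤ) : k) *
          ∏ i, (X ((ofSubtype π * ofSubtype τ) i, i) : MvPolynomial (α × α) k) else 0 := by
    intro π
    have hiff : ∀ τ : Perm ↥(Sᶜ),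
        S ∈ (ofSubtype π * ofSubtype τ).cycleFactorsFinset.image Perm.support ↔
          π.cycleType = {S.card} := fun τ => by
      rw [Finset.mem_image]
      exact exists_mem_cycleFactorsFinset_support_eq_iff S π τ
    by_cases hπ : π.cycleType = {S.card}
    · rw [if_pos hπ]
      exact Finset.sum_congr rfl fun τ _ => if_pos ((hiff τ).2 hπ)
    · rw [if_neg hπ]
      exact Finset.sum_eq_zero fun τ _ => if_neg fun h => hπ ((hiff τ).1 h)
  rw [Finset.sum_congr rfl fun π _ => h3 π, ← Finset.sum_filter]
  by_cases hS : 2 ≤ S.card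
  · rw [if_pos hS, sum_filter_cycleType_eq_card_eq]
  · rw [if_neg hS, filter_cycleType_eq_card_eq_empty S hS, Finset.sum_empty]

/-- **Marked-cycle expansion of the cycle-counting determinant** over any finite index type:
`∑_σ sgn σ · c(σ) · x^σ = ∑_i X_{ii} det(X_{{i}ᶜ}) + ∑_{|S| ≥ 2} (-1)^{|S|-1} HC(X_S) det(X_{Sᶜ})`,
with `c(σ) = card (cycleType σ) + #Fix(σ)` the number of cycles including fixed points. -/
theorem cdet_eq_markedCycle_sum :
    ∑ σ : Perm α, C ((((Perm.sign σ : ℤ) * ((Multiset.card σ.cycleType +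
        (univ.filter (fun i => σ i = i)).card : ℕ) : ℤ)) : ℤ) : k) *
        ∏ i, (X (σ i, i) : MvPolynomial (α × α) k) =
      (∑ i : α, X (i, i) * rename (fun p : ↥(({i} : Finset α)ᶜ) × ↥(({i} : Finset α)ᶜ) =>
        ((p.1 : α), (p.2 : α))) (detPoly ↥(({i} : Finset α)ᶜ) k)) +
      ∑ S : Finset α, (if 2 ≤ S.card then
        C ((-1 : k) ^ (S.card - 1)) *
          rename (fun p : ↥S × ↥S => ((p.1 : α), (p.2 : α))) (hcPoly ↥S k) *
          rename (fun p : ↥(Sᶜ) × ↥(Sᶜ) => ((p.1 : α), (p.2 : α))) (detPoly ↥(Sᶜ) k)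
        else 0) := by
  have hsplit : ∀ σ : Perm α, C ((((Perm.sign σ : ℤ) * ((Multiset.card σ.cycleType +
        (univ.filter (fun i => σ i = i)).card : ℕ) : ℤ)) : ℤ) : k) *
        ∏ i, (X (σ i, i) : MvPolynomial (α × α) k) =
      (univ.filter fun i => σ i = i).card •
          (C (((Perm.sign σ : ℤˣ) : ℤ) : k) * ∏ i, (X (σ i, i) : MvPolynomial (α × α) k)) +
        σ.cycleFactorsFinset.card •
          (C (((Perm.sign σ : ℤˣ) : ℤ) : k) * ∏ i, (X (σ i, i) : MvPolynomial (α × α) k)) := by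
    intro σ
    rw [card_cycleType_eq_card_cycleFactorsFinset, Int.cast_mul, Int.cast_natCast, map_mul,
      map_natCast, nsmul_eq_mul, nsmul_eq_mul]
    push_cast
    ring
  rw [Finset.sum_congr rfl fun σ _ => hsplit σ, Finset.sum_add_distrib,
    sum_card_fixedPoints_smul_eq, sum_card_cycleFactorsFinset_smul_eq]

end Poly

/-- **Item `MarkedCycleExpansion` (stmt-ValiantsHypothesis-5348) of route FermionicJet, proved**:
the marked-cycle normal form `cdet_n = ∑_i X_{ii} det(X_{{i}ᶜ}) + ∑_{|S|≥2} (-1)^{|S|-1} HC(X_S)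
det(X_{Sᶜ})` of the first jet of the fermionic pencil, for every `n`. -/
theorem markedCycleExpansion_proof :
    Summit.ValiantsHypothesis.ValiantsHypothesis.Theses.FermionicJet.MarkedCycleExpansion := by
  intro n
  exact cdet_eq_markedCycle_sum (α := Fin n) (k := ℂ)

end Summit.ValiantsHypothesis.ValiantsHypothesis.Theorems.FermionicJetMarkedCycleExpansion
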